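import Literature.NumberTheory.Automorphic.UnitaryRankTwoCentralizerCompactness     -- ★ `compactSpace_centralizer_cmDatum_two_of_not_exists_isRoot`, `not_compactSpace_centralizer_cmDatum_two_of_split_eigenframe`
import Literature.NumberTheory.Automorphic.RankTwoEigenframeOfSplitCharpoly           -- ★ `exists_eigenframe_cmDatum_local_of_isRoot_map_of_separable`
import Literature.NumberTheory.Automorphic.UnitaryUnitOrbitalIntegralFixedPoints       -- ★ `isRegularElt_val_conj`
import HarnessLib

/-!
# The regular elements of `U(J)(L⁺_v)` in rank 2 at a non-split place: the TORUS TRICHOTOMY (split ∕ type (1) ∕ type (2)) read through compactness of the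
# centraliser, and the diagonalisation INSIDE `U(Φ₂)(L⁺_v)` of a split regular element (Rogawski 1990, §3.5–§3.6)

Topic `NumberTheory/Automorphic`; namespace `Literature.NumberTheory.Automorphic.UnitaryGroup`.  THEOREMS ONLY (no definition, no instance, no notation, no named fact, no
`sorry`, default heartbeats).  Cell `pub/hodgecm-mathlib` (D-0151), crux H413 = `stmt-HodgeConjecture-24833`, line «N6nsGerm» residual `stub_N6nsR2EP : RankOneEulerPoincareNonsplit`,
(R2) EP road, brick **(g-D) «THE NON-ELLIPTIC DICHOTOMY»** (seat B-p14 (g31); glue ★ p842588 `RankOneEulerPoincareGlue` ∕ ★ p842603 `…RankOne`): the letter's binders are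
indexed by `CompactSpace Z(γ)` ∕ `¬ CompactSpace Z(γ)` over ALL regular `γ`, while the counts are computed per torus TYPE (eigenframe data) and the non-elliptic orbital
integrals at DIAGONAL `γ` (★ (L8b)-H token `glDiagonal 2 (LocalRing L v) d = γ.val`).  This file is the dictionary.  HONEST LABEL: HC_CM is proved only modulo the printed
citations until rung 0 closes; elementary structure theory here, no letter is paid.

THE MATHEMATICS.  `L` CM, `v` finite non-split in `L` (`c • w = w`; `E_v = L_w` a field), `J ∈ M₂(L)` hermitian with `det J ≠ 0`, `γ ∈ U(J)(L⁺_v) ⊂ GL₂(E_v)` REGULAR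
(`χ_γ` separable).  Either `χ_γ` has no root in `L_w` — TYPE (2), `Z(γ) ≅ (EK)¹` compact (★ `compactSpace_centralizer_cmDatum_two_of_not_exists_isRoot`) — or it has one, hence
an eigenframe `γP = P·diag(u)`, `u₀ ≠ u₁` (★ `exists_eigenframe_cmDatum_local_of_isRoot_map_of_separable`); unitarity gives `N(det γ) = σ(u₀)u₀ · σ(u₁)u₁ = 1`, so EITHER both
`σ(uᵢ)uᵢ = 1` — TYPE (1), `Z(γ) ≅ L_w¹ × L_w¹` compact (★ `compactSpace_centralizer_of_eigenframe_of_smul_eq`) — OR both `≠ 1` — SPLIT, `Z(γ) ≅ L_w^×` NOT compact (★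
`not_compactSpace_centralizer_cmDatum_two_of_split_eigenframe`).  Hence: `¬ CompactSpace Z(γ) ⟺` split eigenframe; `CompactSpace Z(γ) ⟺` type (1) ∨ type (2).  For the
quasi-split form `J = Φ₂ = antidiag(1,1)` a split frame can be made UNITARY: its Gram matrix `G = ᵗσ(P)Φ₂P` has `(σ(uᵢ)uᵢ − 1)Gᵢᵢ = 0`, so zero diagonal, and `G₁₀ = σ(G₀₁)`,
`G₀₁ ≠ 0` (`det G ≠ 0`); with `P′ := P·diag(1, G₀₁⁻¹)` one gets `ᵗσ(P′)Φ₂P′ = Φ₂`, i.e. `P′ ∈ U(Φ₂)(L⁺_v)` and `P′⁻¹γP′ = diag(u)`: a split regular `γ` is CONJUGATE IN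
`U(Φ₂)(L⁺_v)` to a diagonal element.  Consequently any statement about the classes `⟦γ⟧` of the regular non-elliptic `γ` need only be checked at diagonal `γ`.

* `conjLocal_mul_self_eq_one_iff_of_eigenframe` — `σ(u₀)u₀ = 1 ↔ σ(u₁)u₁ = 1` along an eigenframe of `γ ∈ U(J)(L⁺_v)`.
* `exists_split_eigenframe_of_not_compactSpace_centralizer` (g-D1) · `not_exists_isRoot_or_exists_eigenframe_of_compactSpace_centralizer` (g-D4) ·
  `not_compactSpace_centralizer_iff_exists_split_eigenframe`.
* `exists_conj_val_eq_glDiagonal_of_split_eigenframe`, `exists_conj_val_eq_glDiagonal_of_not_compactSpace_centralizer` (g-D2; `J = Φ₂`).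
* `forall_not_compactSpace_of_forall_glDiagonal` (g-D3): a class predicate holding at the regular diagonal `γ ∈ U(Φ₂)(L⁺_v)` holds at every regular `γ` with non-compact
  centraliser.

## References
* [Rogawski1990] J. D. Rogawski, *Automorphic Representations of Unitary Groups in Three Variables*, Ann. of Math. Stud. 123 (1990): §3.5 p. 29, §3.6 pp. 31–32 (tori of
  `U(2)`, `U(1,1)`).
* [PlatonovRapinchuk1994] V. Platonov, A. Rapinchuk, *Algebraic Groups and Number Theory* (1994): §3.3 (anisotropic tori over local fields are compact), §2.3.
-/

set_option autoImplicit false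

noncomputable section

open NumberField IsDedekindDomain Matrix Polynomial
open scoped Matrix MatrixGroups

namespace Literature.NumberTheory.Automorphic.UnitaryGroup

open Literature.NumberTheory.Rogawski1990
open Literature.AlgebraicGeometry.ShimuraVarieties (unitaryGroup)

section Generic

/-- For `z` with `ᵗσ(z) G z = G` and `det G ≠ 0`: `σ(det z) · det z = 1`. [folklore] -/
private theorem map_det_mul_det_eq_one_of_twist {K : Type*} [Field K] (σ : K →+* K) {n : Type*} [Fintype n] [DecidableEq n] {G : Matrix n n K} (hG : G.det ≠ 0)
    {z : Matrix n n K} (hz : (z.map σ)ᵀ * G * z = G) : σ z.det * z.det = 1 := by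
  have h := congrArg Matrix.det hz
  rw [Matrix.det_mul, Matrix.det_mul, Matrix.det_transpose, ← RingHom.mapMatrix_apply, ← RingHom.map_det] at h
  have h2 : (σ z.det * z.det) * G.det = 1 * G.det := by rw [one_mul]; linear_combination h
  exact mul_right_cancel₀ hG h2

/-- Along an eigenframe `γ P = P · diag(u)` (rank 2): `det γ = u₀ u₁`. [folklore] -/
private theorem det_eq_mul_of_eigenframe {K : Type*} [Field K] {γ : Matrix (Fin 2) (Fin 2) K} {P : GL (Fin 2) K} {u : Fin 2 → K}
    (hP : γ * P.val = P.val * diagonal u) : γ.det = u 0 * u 1 := by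
  have h := congrArg Matrix.det hP
  rw [Matrix.det_mul, Matrix.det_mul, det_diagonal, Fin.prod_univ_two] at h
  have hPd : P.val.det ≠ 0 := by
    have hh := P.isUnit; rw [Matrix.isUnit_iff_isUnit_det] at hh; exact hh.ne_zero
  have h' : P.val.det * γ.det = P.val.det * (u 0 * u 1) := by rw [mul_comm P.val.det γ.det, h]
  exact mul_left_cancel₀ hPd h'

end Generic

section CM

variable (L : Type) [Field L] [NumberField L] [IsCMField L] (v : HeightOneSpectrum (𝓞 ↥(maximalRealSubfield L)))
  (w : PlacesOver L v) (hw : IsCMField.complexConj L • w.1 = w.1) {J : Matrix (Fin 2) (Fin 2) L}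

include hw in
/-- **`N(det γ) = 1` along an eigenframe**: for `γ ∈ U(J)(L⁺_v)` (`J` hermitian, `det J ≠ 0`, `v` non-split) with `γ P = P · diag(u)`, `σ(u₀)u₀ · σ(u₁)u₁ = 1`; hence
`σ(u₀) u₀ = 1 ↔ σ(u₁) u₁ = 1` — type (1) and the split type are the only eigenframe types. [cite: Rogawski1990, §3.6 p. 31] -/
theorem conjLocal_mul_self_eq_one_iff_of_eigenframe (hdet : J.det ≠ 0) (γ : (cmDatum L 2 J).Local v)
    {P : GL (Fin 2) (LocalRing L v)} {u : Fin 2 → LocalRing L v} (hP : γ.val.val * P.val = P.val * diagonal u) :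
    conjLocal L (IsCMField.complexConj L) v (u 0) * u 0 = 1 ↔ conjLocal L (IsCMField.complexConj L) v (u 1) * u 1 = 1 := by
  have hc1 : IsCMField.complexConj L ≠ 1 := IsCMField.complexConj_ne_one L
  letI : Field (LocalRing L v) := (LocalRing.isField_of_smul_eq (IsCMField.complexConj L) hc1 w hw).toField
  have hJvd : ((adelicForm L 2 J).map (adeleToLocal L v)).det ≠ 0 := (isUnit_det_localForm L 2 J v hdet).ne_zero
  have hγU : γ.val ∈ unitaryGroup (conjLocal L (IsCMField.complexConj L) v) ((adelicForm L 2 J).map (adeleToLocal L v)) :=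
    (Literature.AlgebraicGeometry.ShimuraVarieties.mem_unitaryGroup_iff (σ := conjLocal L (IsCMField.complexConj L) v)
      (H := (adelicForm L 2 J).map (adeleToLocal L v)) (g := γ.val)).2
      ((mem_unitaryGroupOfForm_iff (σ := conjLocal L (IsCMField.complexConj L) v) (J := (adelicForm L 2 J).map (adeleToLocal L v)) (g := γ.val)).1 γ.2)
  have hdetγ : conjLocal L (IsCMField.complexConj L) v γ.val.val.det * γ.val.val.det = 1 :=
    map_det_mul_det_eq_one_of_twist (conjLocal L (IsCMField.complexConj L) v) hJvd
      ((Literature.AlgebraicGeometry.ShimuraVarieties.mem_unitaryGroup_iff (σ := conjLocal L (IsCMField.complexConj L) v)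
        (H := (adelicForm L 2 J).map (adeleToLocal L v)) (g := γ.val)).1 hγU)
  rw [det_eq_mul_of_eigenframe hP, map_mul] at hdetγ
  have key : (conjLocal L (IsCMField.complexConj L) v (u 0) * u 0) * (conjLocal L (IsCMField.complexConj L) v (u 1) * u 1) = 1 := by
    calc (conjLocal L (IsCMField.complexConj L) v (u 0) * u 0) * (conjLocal L (IsCMField.complexConj L) v (u 1) * u 1)
        = conjLocal L (IsCMField.complexConj L) v (u 0) * conjLocal L (IsCMField.complexConj L) v (u 1) * (u 0 * u 1) := by ring
      _ = 1 := hdetγ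
  constructor
  · intro h0; rwa [h0, one_mul] at key
  · intro h1; rwa [h1, mul_one] at key

include hw in
/-- **(g-D1) A REGULAR `γ ∈ U(J)(L⁺_v)` WITH NON-COMPACT CENTRALISER HAS A SPLIT EIGENFRAME** (`J` hermitian, `det J ≠ 0`, rank 2, `v` non-split): `γ P = P · diag(u)`, `u₀ ≠ u₁`,
`σ(u₀) u₀ ≠ 1`.  (No root ⇒ type (2) ⇒ compact ★; a root ⇒ eigenframe ★; `σ(u₀)u₀ = 1` ⇒ type (1) ⇒ compact ★.) [cite: Rogawski1990, §3.6 pp. 31–32] [cite: PlatonovRapinchuk1994, §3.3] -/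
theorem exists_split_eigenframe_of_not_compactSpace_centralizer (hJ : (J.map (cmConjRingHom L))ᵀ = J) (hdet : J.det ≠ 0) (γ : (cmDatum L 2 J).Local v)
    (hreg : IsRegularElt (γ.val : GL (Fin 2) (LocalRing L v))) (hnc : ¬ CompactSpace (Subgroup.centralizer ({γ} : Set ((cmDatum L 2 J).Local v)))) :
    ∃ (P : GL (Fin 2) (LocalRing L v)) (u : Fin 2 → LocalRing L v),
      γ.val.val * P.val = P.val * diagonal u ∧ Function.Injective u ∧ conjLocal L (IsCMField.complexConj L) v (u 0) * u 0 ≠ 1 := by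
  by_cases hroot : ∃ x : w.1.adicCompletion L, ((((γ.val : GL (Fin 2) (LocalRing L v)) : Matrix (Fin 2) (Fin 2) (LocalRing L v)).charpoly.map
      (Pi.evalRingHom (fun w' : PlacesOver L v => w'.1.adicCompletion L) w)).IsRoot x)
  · obtain ⟨α, hα⟩ := hroot
    obtain ⟨P, u, hP, hu, -⟩ := exists_eigenframe_cmDatum_local_of_isRoot_map_of_separable L v w hw γ hα hreg
    refine ⟨P, u, hP, hu, fun h0 => hnc ?_⟩
    have h1 := (conjLocal_mul_self_eq_one_iff_of_eigenframe L v w hw hdet γ hP).1 h0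
    exact compactSpace_centralizer_of_eigenframe_of_smul_eq L w hw J hJ hdet γ hP hu (fun i => by fin_cases i <;> assumption)
  · exact absurd (compactSpace_centralizer_cmDatum_two_of_not_exists_isRoot L v w hw hdet γ (by rwa [Matrix.charpoly_map])) hnc

include hw in
/-- **(g-D4) A REGULAR `γ ∈ U(J)(L⁺_v)` WITH COMPACT CENTRALISER IS OF TYPE (2) OR OF TYPE (1)**: either `χ_{γ,w}` has no root in `L_w`, or `γ` has an eigenframe
`γ P = P · diag(u)`, `u₀ ≠ u₁`, with `σ(uᵢ) uᵢ = 1` for both `i` (a split frame would make `Z(γ)` non-compact ★). [cite: Rogawski1990, §3.6 pp. 31–32] [cite: PlatonovRapinchuk1994, §3.3] -/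
theorem not_exists_isRoot_or_exists_eigenframe_of_compactSpace_centralizer (hJ : (J.map (cmConjRingHom L))ᵀ = J) (hdet : J.det ≠ 0) (γ : (cmDatum L 2 J).Local v)
    (hreg : IsRegularElt (γ.val : GL (Fin 2) (LocalRing L v))) (hc : CompactSpace (Subgroup.centralizer ({γ} : Set ((cmDatum L 2 J).Local v)))) :
    (¬ ∃ x : w.1.adicCompletion L, ((((γ.val : GL (Fin 2) (LocalRing L v)) : Matrix (Fin 2) (Fin 2) (LocalRing L v)).charpoly.map
        (Pi.evalRingHom (fun w' : PlacesOver L v => w'.1.adicCompletion L) w)).IsRoot x)) ∨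
      ∃ (P : GL (Fin 2) (LocalRing L v)) (u : Fin 2 → LocalRing L v),
        γ.val.val * P.val = P.val * diagonal u ∧ Function.Injective u ∧ ∀ i, conjLocal L (IsCMField.complexConj L) v (u i) * u i = 1 := by
  by_cases hroot : ∃ x : w.1.adicCompletion L, ((((γ.val : GL (Fin 2) (LocalRing L v)) : Matrix (Fin 2) (Fin 2) (LocalRing L v)).charpoly.map
      (Pi.evalRingHom (fun w' : PlacesOver L v => w'.1.adicCompletion L) w)).IsRoot x)
  · right
    obtain ⟨α, hα⟩ := hroot
    obtain ⟨P, u, hP, hu, -⟩ := exists_eigenframe_cmDatum_local_of_isRoot_map_of_separable L v w hw γ hα hreg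
    by_cases h0 : conjLocal L (IsCMField.complexConj L) v (u 0) * u 0 = 1
    · have h1 := (conjLocal_mul_self_eq_one_iff_of_eigenframe L v w hw hdet γ hP).1 h0
      exact ⟨P, u, hP, hu, fun i => by fin_cases i <;> assumption⟩
    · exact absurd hc (not_compactSpace_centralizer_cmDatum_two_of_split_eigenframe L v w hw hJ hdet γ hP h0)
  · exact Or.inl hroot

include hw in
/-- **`¬ CompactSpace Z(γ) ↔ γ` has a split eigenframe**, for regular `γ ∈ U(J)(L⁺_v)` (rank 2, `v` non-split). [cite: Rogawski1990, §3.6 pp. 31–32] [cite: PlatonovRapinchuk1994, §3.3] -/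
theorem not_compactSpace_centralizer_iff_exists_split_eigenframe (hJ : (J.map (cmConjRingHom L))ᵀ = J) (hdet : J.det ≠ 0) (γ : (cmDatum L 2 J).Local v)
    (hreg : IsRegularElt (γ.val : GL (Fin 2) (LocalRing L v))) :
    ¬ CompactSpace (Subgroup.centralizer ({γ} : Set ((cmDatum L 2 J).Local v))) ↔
      ∃ (P : GL (Fin 2) (LocalRing L v)) (u : Fin 2 → LocalRing L v),
        γ.val.val * P.val = P.val * diagonal u ∧ Function.Injective u ∧ conjLocal L (IsCMField.complexConj L) v (u 0) * u 0 ≠ 1 :=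
  ⟨exists_split_eigenframe_of_not_compactSpace_centralizer L v w hw hJ hdet γ hreg,
    fun ⟨_, _, hP, _, h0⟩ => not_compactSpace_centralizer_cmDatum_two_of_split_eigenframe L v w hw hJ hdet γ hP h0⟩

end CM

/-! ## The quasi-split form `Φ₂`: diagonalisation inside `U(Φ₂)(L⁺_v)` -/

section QuasiSplit

variable (L : Type) [Field L] [NumberField L] [IsCMField L] (v : HeightOneSpectrum (𝓞 ↥(maximalRealSubfield L)))
  (w : PlacesOver L v) (hw : IsCMField.complexConj L • w.1 = w.1)

omit [IsCMField L] in
/-- The local form of `Φ₂` over `E_v` is the literal `antidiag(1, 1)`. [cite: Rogawski1990, §3.5 p. 29] -/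
private theorem localForm_antidiagTwo :
    (adelicForm L 2 (Matrix.of fun i j : Fin 2 => if i.val + j.val + 1 = 2 then (1 : L) else 0)).map (adeleToLocal L v) =
      Matrix.of fun i j : Fin 2 => if i.val + j.val + 1 = 2 then (1 : LocalRing L v) else 0 := by
  rw [adelicForm_map_adeleToLocal]
  ext i j
  simp only [map_apply, of_apply]
  split_ifs <;> simp

include hw in
/-- **(g-D2) A SPLIT EIGENFRAME OF `γ ∈ U(Φ₂)(L⁺_v)` CAN BE MADE UNITARY**: if `γ P = P · diag(u)` with `σ(u₀) u₀ ≠ 1`, there are `g ∈ U(Φ₂)(L⁺_v)` and units `d` with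
`(g γ g⁻¹).val = glDiagonal 2 d` (`dᵢ = uᵢ`; `g = P′⁻¹`, `P′ = P · diag(1, G₀₁⁻¹)`, `G = ᵗσ(P) Φ₂ P` — zero diagonal, `G₁₀ = σ(G₀₁) ≠ 0`).
[cite: Rogawski1990, §3.6 p. 31; §3.5 p. 29] [cite: PlatonovRapinchuk1994, §2.3] -/
theorem exists_conj_val_eq_glDiagonal_of_split_eigenframe
    (γ : (cmDatum L 2 (Matrix.of fun i j : Fin 2 => if i.val + j.val + 1 = 2 then (1 : L) else 0)).Local v)
    {P : GL (Fin 2) (LocalRing L v)} {u : Fin 2 → LocalRing L v} (hP : γ.val.val * P.val = P.val * diagonal u)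
    (h0 : conjLocal L (IsCMField.complexConj L) v (u 0) * u 0 ≠ 1) :
    ∃ (g : (cmDatum L 2 (Matrix.of fun i j : Fin 2 => if i.val + j.val + 1 = 2 then (1 : L) else 0)).Local v) (d : Fin 2 → (LocalRing L v)ˣ),
      glDiagonal 2 (LocalRing L v) d = ((g * γ * g⁻¹).val : GL (Fin 2) (LocalRing L v)) ∧ (∀ i, (d i : LocalRing L v) = u i) ∧
        conjLocal L (IsCMField.complexConj L) v (d 0 : LocalRing L v) * d 0 ≠ 1 := by
  classical
  have hc1 : IsCMField.complexConj L ≠ 1 := IsCMField.complexConj_ne_one L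
  letI : Field (LocalRing L v) := (LocalRing.isField_of_smul_eq (IsCMField.complexConj L) hc1 w hw).toField
  set σ := conjLocal L (IsCMField.complexConj L) v with hσdef
  set Jv : Matrix (Fin 2) (Fin 2) (LocalRing L v) :=
    (adelicForm L 2 (Matrix.of fun i j : Fin 2 => if i.val + j.val + 1 = 2 then (1 : L) else 0)).map (adeleToLocal L v) with hJv
  have hJ : ((Matrix.of fun i j : Fin 2 => if i.val + j.val + 1 = 2 then (1 : L) else 0).map (cmConjRingHom L))ᵀ =
      Matrix.of fun i j : Fin 2 => if i.val + j.val + 1 = 2 then (1 : L) else 0 := antidiagOne_isHermitian L 2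
  have hdet : (Matrix.of fun i j : Fin 2 => if i.val + j.val + 1 = 2 then (1 : L) else 0).det ≠ 0 := (isUnit_antidiagOne_det L 2).ne_zero
  have hJvh : (Jv.map σ)ᵀ = Jv := map_conjLocal_transpose_localForm L 2 _ v hJ
  have hJvd : Jv.det ≠ 0 := (isUnit_det_localForm L 2 _ v hdet).ne_zero
  have hJvlit : Jv = Matrix.of fun i j : Fin 2 => if i.val + j.val + 1 = 2 then (1 : LocalRing L v) else 0 := localForm_antidiagTwo L v
  have hσσ : ∀ x, σ (σ x) = x := conjLocal_conjLocal (IsCMField.complexConj L) v (GelbartRogawski1991.UnitaryDualPair.complexConj_imagUnit L)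
    (GelbartRogawski1991.UnitaryDualPair.imagUnit_ne_zero L)
  have hγU : γ.val ∈ unitaryGroup σ Jv :=
    (Literature.AlgebraicGeometry.ShimuraVarieties.mem_unitaryGroup_iff (σ := σ) (H := Jv) (g := γ.val)).2
      ((mem_unitaryGroupOfForm_iff (σ := σ) (J := Jv) (g := γ.val)).1 γ.2)
  -- the frame Gram matrix and its shape
  set G := twistGram σ Jv P.val with hG
  have hframe : (diagonal fun i => σ (u i)) * G * diagonal u = G := by
    have h1 : twistGram σ Jv (γ.val.val * P.val) = twistGram σ Jv P.val := twistGram_unitary_mul σ Jv hγU _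
    rwa [hP, twistGram_mul, diagonal_map (map_zero σ), diagonal_transpose] at h1
  have hdiag : ∀ i, (σ (u i) * u i - 1) * G i i = 0 := fun i => by
    have h := congrFun (congrFun hframe i) i
    rw [mul_diagonal, diagonal_mul] at h
    linear_combination h
  have h1 : σ (u 1) * u 1 ≠ 1 := fun h1 => h0 ((conjLocal_mul_self_eq_one_iff_of_eigenframe L v w hw hdet γ hP).2 h1)
  have hG00 : G 0 0 = 0 := (mul_eq_zero.1 (hdiag 0)).resolve_left (sub_ne_zero.2 h0)
  have hG11 : G 1 1 = 0 := (mul_eq_zero.1 (hdiag 1)).resolve_left (sub_ne_zero.2 h1)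
  have hGh : (G.map σ)ᵀ = G := conjTranspose_twistGram σ Jv hσσ hJvh P.val
  have hG10 : G 1 0 = σ (G 0 1) := by
    have h := congrFun (congrFun hGh 1) 0
    rw [transpose_apply, map_apply] at h
    exact h.symm
  have hGd : G.det ≠ 0 := by
    rw [hG, twistGram_def, Matrix.det_mul, Matrix.det_mul, Matrix.det_transpose, ← RingHom.mapMatrix_apply, ← RingHom.map_det]
    have hPd : P.val.det ≠ 0 := by
      have hh := P.isUnit; rw [Matrix.isUnit_iff_isUnit_det] at hh; exact hh.ne_zero
    exact mul_ne_zero (mul_ne_zero ((map_ne_zero σ).2 hPd) hJvd) hPd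
  have hx : G 0 1 ≠ 0 := by
    intro hx0
    apply hGd
    rw [Matrix.det_fin_two, hG00, hG11, hx0, zero_mul, zero_mul, sub_zero]
  -- the rescaling `D = diag(1, s)`, `G₀₁ s = 1`, and the unitary frame `P′ = P D`
  have hxu : IsUnit (G 0 1) := Ne.isUnit hx
  set s : LocalRing L v := ↑(hxu.unit⁻¹) with hsdef
  have hxs : G 0 1 * s = 1 := hxu.mul_val_inv
  have hs0 : s ≠ 0 := fun hs => by rw [hs, mul_zero] at hxs; exact zero_ne_one hxs
  have hJv00 : Jv 0 0 = 0 := by rw [hJvlit]; simp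
  have hJv01 : Jv 0 1 = 1 := by rw [hJvlit]; simp
  have hJv10 : Jv 1 0 = 1 := by rw [hJvlit]; simp
  have hJv11 : Jv 1 1 = 0 := by rw [hJvlit]; simp
  set dd : Fin 2 → LocalRing L v := ![1, s] with hdd
  have hdd0 : dd 0 = 1 := rfl
  have hdd1 : dd 1 = s := rfl
  have hDdet : (diagonal dd).det ≠ 0 := by
    rw [det_diagonal, Fin.prod_univ_two, hdd0, hdd1, one_mul]; exact hs0
  set D : GL (Fin 2) (LocalRing L v) := Matrix.GeneralLinearGroup.mkOfDetNeZero (diagonal dd) hDdet with hDdef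
  have hDval : D.val = diagonal dd := rfl
  have hDG : (diagonal fun i => σ (dd i)) * G * diagonal dd = Jv := by
    refine Matrix.ext fun i j => ?_
    rw [mul_diagonal, diagonal_mul]
    fin_cases i <;> fin_cases j <;> simp only [Fin.zero_eta, Fin.mk_one, Fin.isValue, hdd0, hdd1]
    · rw [hJv00, hG00, mul_zero, zero_mul]
    · rw [hJv01, map_one, one_mul, hxs]
    · rw [hJv10, hG10, mul_one, ← map_mul, mul_comm, hxs, map_one]
    · rw [hJv11, hG11, mul_zero, zero_mul]
  have hP'U : P * D ∈ unitaryGroup σ Jv := by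
    rw [← twistGram_coe_eq_iff_mem_unitaryGroup, Units.val_mul, twistGram_mul, hDval, diagonal_map (map_zero σ), diagonal_transpose, ← hG, hDG]
  have hP' : γ.val.val * (P * D).val = (P * D).val * diagonal u := by
    rw [Units.val_mul, hDval, ← Matrix.mul_assoc, hP, Matrix.mul_assoc, Matrix.mul_assoc, diagonal_mul_diagonal, diagonal_mul_diagonal]
    congr 2; funext i; exact mul_comm _ _
  -- the eigenvalues are units (`det γ = u₀ u₁ ≠ 0`)
  have hγd : γ.val.val.det ≠ 0 := by
    have hh := γ.val.isUnit; rw [Matrix.isUnit_iff_isUnit_det] at hh; exact hh.ne_zero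
  have hu0 : ∀ i, u i ≠ 0 := by
    have h := det_eq_mul_of_eigenframe hP
    intro i; fin_cases i
    · intro h0; apply hγd; rw [h]; exact mul_eq_zero_of_left h0 _
    · intro h0; apply hγd; rw [h]; exact mul_eq_zero_of_right _ h0
  let d : Fin 2 → (LocalRing L v)ˣ := fun i => (Ne.isUnit (hu0 i)).unit
  let p' : (cmDatum L 2 (Matrix.of fun i j : Fin 2 => if i.val + j.val + 1 = 2 then (1 : L) else 0)).Local v :=
    ⟨P * D, (mem_unitaryGroupOfForm_iff (σ := σ) (J := Jv) (g := P * D)).2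
      ((Literature.AlgebraicGeometry.ShimuraVarieties.mem_unitaryGroup_iff (σ := σ) (H := Jv) (g := P * D)).1 hP'U)⟩
  refine ⟨p'⁻¹, d, ?_, fun i => rfl, h0⟩
  -- `(P′⁻¹ γ P′).val = diag(u)`
  refine Units.ext ?_
  have hval : ((p'⁻¹ * γ * p'⁻¹⁻¹).val : GL (Fin 2) (LocalRing L v)) = (P * D)⁻¹ * γ.val * (P * D) := by
    rw [inv_inv]; rfl
  rw [hval, coe_glDiagonal, Units.val_mul, Units.val_mul, Matrix.mul_assoc, hP', ← Matrix.mul_assoc, ← Units.val_mul, inv_mul_cancel, Units.val_one,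
    Matrix.one_mul]
  exact congrArg diagonal (funext fun k => IsUnit.unit_spec _)

include hw in
/-- **(g-D2′) A REGULAR `γ ∈ U(Φ₂)(L⁺_v)` WITH NON-COMPACT CENTRALISER IS CONJUGATE IN `U(Φ₂)(L⁺_v)` TO A DIAGONAL ELEMENT** `glDiagonal 2 d`, `σ(d₀) d₀ ≠ 1`, `d₀ ≠ d₁`
(★ (L8b)-H token shape `glDiagonal 2 (LocalRing L v) d = γ.val`). [cite: Rogawski1990, §3.6 pp. 31–32] [cite: PlatonovRapinchuk1994, §3.3] -/
theorem exists_conj_val_eq_glDiagonal_of_not_compactSpace_centralizer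
    (γ : (cmDatum L 2 (Matrix.of fun i j : Fin 2 => if i.val + j.val + 1 = 2 then (1 : L) else 0)).Local v)
    (hreg : IsRegularElt (γ.val : GL (Fin 2) (LocalRing L v)))
    (hnc : ¬ CompactSpace (Subgroup.centralizer
      ({γ} : Set ((cmDatum L 2 (Matrix.of fun i j : Fin 2 => if i.val + j.val + 1 = 2 then (1 : L) else 0)).Local v)))) :
    ∃ (g : (cmDatum L 2 (Matrix.of fun i j : Fin 2 => if i.val + j.val + 1 = 2 then (1 : L) else 0)).Local v) (d : Fin 2 → (LocalRing L v)ˣ),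
      glDiagonal 2 (LocalRing L v) d = ((g * γ * g⁻¹).val : GL (Fin 2) (LocalRing L v)) ∧ d 0 ≠ d 1 ∧
        conjLocal L (IsCMField.complexConj L) v (d 0 : LocalRing L v) * d 0 ≠ 1 := by
  obtain ⟨P, u, hP, hu, h0⟩ := exists_split_eigenframe_of_not_compactSpace_centralizer L v w hw (antidiagOne_isHermitian L 2)
    (isUnit_antidiagOne_det L 2).ne_zero γ hreg hnc
  obtain ⟨g, d, hd, hdu, hd0⟩ := exists_conj_val_eq_glDiagonal_of_split_eigenframe L v w hw γ hP h0
  refine ⟨g, d, hd, fun h01 => ?_, hd0⟩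
  have h : u 0 = u 1 := by rw [← hdu 0, ← hdu 1, h01]
  exact absurd (hu h) (by decide)

include hw in
/-- **(g-D3) REDUCTION TO DIAGONAL REPRESENTATIVES.**  A property of the conjugacy classes of `U(Φ₂)(L⁺_v)` that holds at `⟦γ⟧` for every REGULAR DIAGONAL `γ`
(`glDiagonal 2 d = γ.val`) holds at `⟦γ⟧` for every regular `γ` with NON-COMPACT centraliser (`⟦γ⟧ = ⟦g γ g⁻¹⟧`, regularity is a class function ★ `isRegularElt_val_conj`) —
so the non-elliptic clause of ★ `RankOneEulerPoincareNonsplit` ∕ the binder `hN` of ★ `exists_isLocSmooth_classOrbitalIntegral_eq_one_zero_of_relations` is paid by the split-torus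
computations at diagonal `γ` alone. [cite: Rogawski1990, §3.6 pp. 31–32; §4.9 p. 54] -/
theorem forall_not_compactSpace_of_forall_glDiagonal
    {Q : ConjClasses ((cmDatum L 2 (Matrix.of fun i j : Fin 2 => if i.val + j.val + 1 = 2 then (1 : L) else 0)).Local v) → Prop}
    (hQ : ∀ γ : (cmDatum L 2 (Matrix.of fun i j : Fin 2 => if i.val + j.val + 1 = 2 then (1 : L) else 0)).Local v,
      IsRegularElt (γ.val : GL (Fin 2) (LocalRing L v)) → (∃ d : Fin 2 → (LocalRing L v)ˣ, glDiagonal 2 (LocalRing L v) d = (γ.val : GL (Fin 2) (LocalRing L v))) →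
        Q (ConjClasses.mk γ))
    (γ : (cmDatum L 2 (Matrix.of fun i j : Fin 2 => if i.val + j.val + 1 = 2 then (1 : L) else 0)).Local v)
    (hreg : IsRegularElt (γ.val : GL (Fin 2) (LocalRing L v)))
    (hnc : ¬ CompactSpace (Subgroup.centralizer
      ({γ} : Set ((cmDatum L 2 (Matrix.of fun i j : Fin 2 => if i.val + j.val + 1 = 2 then (1 : L) else 0)).Local v)))) :
    Q (ConjClasses.mk γ) := by
  obtain ⟨g, d, hd, -, -⟩ := exists_conj_val_eq_glDiagonal_of_not_compactSpace_centralizer L v w hw γ hreg hnc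
  have hcl : ConjClasses.mk (g * γ * g⁻¹) = ConjClasses.mk γ := ConjClasses.mk_eq_mk_iff_isConj.2 (isConj_iff.2 ⟨g, rfl⟩).symm
  rw [← hcl]
  exact hQ (g * γ * g⁻¹) (isRegularElt_val_conj L 2 _ v γ g hreg) ⟨d, hd⟩

end QuasiSplit

end Literature.NumberTheory.Automorphic.UnitaryGroup

end
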